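import Summits.Ventures.DiscreteObjects.PP12.FlagSideCensus

/-!
# Pencil census for a flag-type collineation of order 3: exterior lines through any non-fixed point off `l`, and the T-line structure (kernel)
Framing: lottery ticket; floor = certified bounds/negative ranges.

Cell pub-namedobj (venture DiscreteObjects), target (M), designs gen 13; Step C/D groundwork of the `FlagTenOrbitReduction` roadmap
(HOME FAMILY-FLAG7X §7), valid for EVERY flag sub-cell `f`. Flag setting as in `FlagExterior` (`σ³ = 1` where stated).
* **`card_exterior_lines_through_off_l`** (order 12) — through every non-fixed point `w ∉ l` (an exterior point OR a T-point on some `m_j`)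
  pass exactly `13 − f` lines carrying no fixed point (`f` = number of fixed points): the `f` lines `w·y`, `y` fixed, are pairwise distinct.
  (Generalises `FlagExteriorPencil.card_exterior_lines_through_eq`, which assumed `w` on no fixed line.) Orbit level: the fibres of `γ_j`
  have size `13 − f − … = 3` for `f = 10`, `x_i + y_i = 11 − f`, etc.
* **`card_exterior_points_on_tline`** (order 12; the dual count) — a T-line `b` (through a fixed point `y ≠ c`, `b ≠ l`) carries exactly
  `13 − f` points lying on no fixed line.
* `exterior_lines_through_tpoint_distinct_orbits` — two exterior lines through a non-fixed point of a fixed line are never in the same orbit;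
* `tline_exterior_distinct_clines` — two exterior points of a T-line lie on different lines through `c`;
* `tline_orbit_of_fixedLine_orbit` — the orbit of a T-line through `y` is determined by the orbit of its point on any fixed line `m ≠ l`
  (the bijections `β_kj` of the orbit data are well defined and injective).
No `sorry`, no new axioms.
-/

namespace Summit.Ventures.DiscreteObjects.PP12

open Configuration Finset
open scoped Classical

namespace Collineation

variable {P L : Type*} [Membership P L] [ProjectivePlane P L] [Fintype P] [Fintype L] (σ : Collineation P L)

section Flag

variable {l : L} {c : P} (hl : σ.onLines l = l) (hc : σ.onPoints c = c) (hcl : c ∈ l)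
  (hP : ∀ p : P, σ.onPoints p = p → p ∈ l) (hL : ∀ m : L, σ.onLines m = m → c ∈ m)

include hP in
/-- **Exterior lines through a non-fixed point off `l` (order 12).** If `σw ≠ w` and `w ∉ l`, exactly `13 − f` lines through `w` carry no
fixed point, `f = fixedCard σ.onPoints`: the map `y ↦ w·y` on the fixed points is injective (two fixed points span `l ∌ w`), and its image
is the set of lines through `w` meeting the fixed set. -/
theorem card_exterior_lines_through_off_l (h12 : ProjectivePlane.order P L = 12) {w : P} (hw : σ.onPoints w ≠ w) (hwl : w ∉ l) :
    (univ.filter fun x : L => w ∈ x ∧ ∀ p : P, σ.onPoints p = p → p ∉ x).card = 13 - fixedCard σ.onPoints := by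
  set Fx : Finset P := univ.filter fun p : P => σ.onPoints p = p with hFx
  have hFcard : Fx.card = fixedCard σ.onPoints := rfl
  set LW : Finset L := univ.filter fun x : L => w ∈ x with hLW
  have hLW13 : LW.card = 13 := by
    rw [hLW, ← Fintype.card_subtype, ← Nat.card_eq_fintype_card]
    have := ProjectivePlane.lineCount_eq L w
    rw [h12] at this; exact this
  have hwne : ∀ y ∈ Fx, w ≠ y := by
    intro y hy e; subst e
    exact hw (by simpa [hFx] using hy)
  haveI : Nonempty L := ⟨l⟩
  let g : P → L := fun y => if h : w ≠ y then HasLines.mkLine h else l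
  have hg : ∀ y ∈ Fx, w ∈ g y ∧ y ∈ g y := fun y hy => by
    simp only [g, dif_pos (hwne y hy)]; exact HasLines.mkLine_ax (hwne y hy)
  have hginj : Set.InjOn g Fx := by
    intro y hy y' hy' heq
    by_contra hne
    have fy : σ.onPoints y = y := by simpa [hFx] using hy
    have fy' : σ.onPoints y' = y' := by simpa [hFx] using hy'
    have h1 := hg y hy; have h2 := hg y' hy'
    rw [← heq] at h2
    -- g y contains the fixed points y ≠ y', both on l, hence g y = l ∋ w
    have : g y = l := (Nondegenerate.eq_or_eq h1.2 h2.2 (hP y fy) (hP y' fy')).resolve_left hne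
    exact hwl (this ▸ h1.1)
  set EW : Finset L := univ.filter fun x : L => w ∈ x ∧ ∀ p : P, σ.onPoints p = p → p ∉ x with hEW
  have hunion : Fx.image g ∪ EW = LW := by
    apply Finset.Subset.antisymm
    · intro x hx
      rcases Finset.mem_union.mp hx with hx | hx
      · obtain ⟨y, hy, rfl⟩ := Finset.mem_image.mp hx
        simp [hLW, (hg y hy).1]
      · simp only [hEW, mem_filter, mem_univ, true_and] at hx; simp [hLW, hx.1]
    · intro x hx
      have hwx : w ∈ x := by simpa [hLW] using hx
      by_cases hex : ∃ p : P, σ.onPoints p = p ∧ p ∈ x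
      swap
      · refine Finset.mem_union.mpr (Or.inr ?_)
        simp only [hEW, mem_filter, mem_univ, true_and]
        exact ⟨hwx, fun p fp hpx => hex ⟨p, fp, hpx⟩⟩
      · obtain ⟨p, fp, hpx⟩ := hex
        have hp : p ∈ Fx := by simp [hFx, fp]
        have hgp := hg p hp
        have hx_eq : x = g p := by
          rcases Nondegenerate.eq_or_eq hwx hpx hgp.1 hgp.2 with h | h
          · exact absurd h (hwne p hp)
          · exact h
        exact Finset.mem_union.mpr (Or.inl (Finset.mem_image.mpr ⟨p, hp, hx_eq.symm⟩))
  have hdisj : Disjoint (Fx.image g) EW := by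
    rw [Finset.disjoint_left]
    intro x hx hx'
    obtain ⟨y, hy, rfl⟩ := Finset.mem_image.mp hx
    have fy : σ.onPoints y = y := by simpa [hFx] using hy
    simp only [hEW, mem_filter, mem_univ, true_and] at hx'
    exact hx'.2 y fy (hg y hy).2
  have hcard : (Fx.image g).card + EW.card = LW.card := by
    rw [← Finset.card_union_of_disjoint hdisj, hunion]
  rw [Finset.card_image_of_injOn hginj, hFcard, hLW13] at hcard
  omega

include hL in
/-- **Exterior points on a T-line (order 12; the dual count).** A line `b ≠ l`... more precisely: a non-fixed line `b` not through `c`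
carries exactly `13 − g` points lying on no fixed line (`g` = number of fixed lines `= f` by Baer's equality). -/
theorem card_exterior_points_on_line_off_c (h12 : ProjectivePlane.order P L = 12) {b : L} (hb : σ.onLines b ≠ b) (hcb : c ∉ b) :
    (univ.filter fun p : P => p ∈ b ∧ ∀ m : L, σ.onLines m = m → p ∉ m).card = 13 - fixedCard σ.onPoints := by
  have h12' : ProjectivePlane.order (Dual L) (Dual P) = 12 := by rw [ProjectivePlane.Dual.order]; exact h12
  have h := σ.dual.card_exterior_lines_through_off_l (l := (c : Dual P)) hL h12' hb hcb
  rw [σ.fixedCard_points_eq_lines]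
  exact h

include hcl hP hL in
/-- A T-line `b ∋ y` (`y ≠ c` fixed, `b ≠ l`) carries exactly `13 − f` exterior points (order 12). -/
theorem card_exterior_points_on_tline (h12 : ProjectivePlane.order P L = 12) {y : P} (hy : σ.onPoints y = y) (hyc : y ≠ c)
    {b : L} (hyb : y ∈ b) (hbl : b ≠ l) :
    (univ.filter fun p : P => p ∈ b ∧ ∀ m : L, σ.onLines m = m → p ∉ m).card = 13 - fixedCard σ.onPoints :=
  σ.card_exterior_points_on_line_off_c hL h12 (σ.tline_not_fixed hcl hP hL hy hyc hyb hbl) (σ.c_not_mem_tline hcl hP hy hyc hyb hbl)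

omit [Fintype P] [Fintype L] in
include hL hc in
/-- **Exterior lines through a point of a fixed line are in distinct orbits** (`σ³ = 1`): if `w` lies on the fixed line `m`, `σw ≠ w`, and
`x, x'` are lines through `w` carrying no fixed point with `x'` in the orbit of `x`, then `x' = x`. -/
theorem exterior_lines_through_tpoint_distinct_orbits (hq : σ.onPoints ^ 3 = 1) {m : L} (hm : σ.onLines m = m) {w : P}
    (hwm : w ∈ m) (hw : σ.onPoints w ≠ w) {x x' : L} (hwx : w ∈ x) (hx0 : ∀ p : P, σ.onPoints p = p → p ∉ x)
    (hwx' : w ∈ x') (hx'0 : ∀ p : P, σ.onPoints p = p → p ∉ x') (h : x' ∈ orb3 σ.onLines x) : x' = x := by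
  rw [mem_orb3] at h
  have hσw : σ.onPoints w ∈ m := (σ.mem_fixedLine_iff hm w).2 hwm
  have hσσw : σ.onPoints (σ.onPoints w) ∈ m := (σ.mem_fixedLine_iff hm _).2 hσw
  have hx'm : x' ≠ m := fun e => hx'0 c hc (e ▸ hL m hm)
  rcases h with rfl | rfl | rfl
  · rfl
  · -- σx ∋ σw and w; both on m, distinct ⇒ σx = m
    exfalso
    have h1 : σ.onPoints w ∈ σ.onLines x := σ.mem_map hwx
    exact hx'm ((Nondegenerate.eq_or_eq hwx' h1 hwm hσw).resolve_left hw.symm)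
  · exfalso
    have h1 : σ.onPoints (σ.onPoints w) ∈ σ.onLines (σ.onLines x) := σ.mem_map (σ.mem_map hwx)
    have hne : w ≠ σ.onPoints (σ.onPoints w) := fun e => by
      apply hw; have := congrArg σ.onPoints e; rw [apply_three σ.onPoints hq w] at this; exact this
    exact hx'm ((Nondegenerate.eq_or_eq hwx' h1 hwm hσσw).resolve_left hne)

omit [Fintype P] [Fintype L] in
include hcl hP in
/-- Two distinct points of a T-line `b ∋ y` that lie on lines through `c` lie on DIFFERENT lines through `c` (else `b ∋ c`). -/
theorem tline_exterior_distinct_clines {y : P} (hy : σ.onPoints y = y) (hyc : y ≠ c) {b : L} (hyb : y ∈ b) (hbl : b ≠ l)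
    {p p' : P} (hpb : p ∈ b) (hp'b : p' ∈ b) (hpp' : p ≠ p') {u : L} (hcu : c ∈ u) (hpu : p ∈ u) (hp'u : p' ∈ u) : False :=
  σ.c_not_mem_tline hcl hP hy hyc hyb hbl (((Nondegenerate.eq_or_eq hpb hp'b hpu hp'u).resolve_left hpp') ▸ hcu)

omit [Fintype P] [Fintype L] in
/-- **`β` is well defined and injective:** for two lines `b, b' ≠ l` through the same fixed point `y` and a fixed line `m`, if their points
on `m` lie in one orbit then `b'` lies in the orbit of `b` (`σ³ = 1`). -/
theorem tline_orbit_of_fixedLine_orbit {y : P} (hy : σ.onPoints y = y) {b b' : L} (hyb : y ∈ b)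
    (hyb' : y ∈ b') {m : L} {w w' : P} (hwb : w ∈ b) (hwm : w ∈ m) (hw'b' : w' ∈ b') (hw'm : w' ∈ m) (hym : y ∉ m)
    (h : w' ∈ orb3 σ.onPoints w) : b' ∈ orb3 σ.onLines b := by
  rw [mem_orb3] at h ⊢
  have hyσ : ∀ e : L, y ∈ e → y ∈ σ.onLines e := fun e he => by have := σ.mem_map he; rwa [hy] at this
  have hw'y : w' ≠ y := fun e => hym (e ▸ hw'm)
  rcases h with rfl | rfl | rfl
  · exact Or.inl ((Nondegenerate.eq_or_eq hw'b' hyb' hwb hyb).resolve_left hw'y)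
  · exact Or.inr (Or.inl ((Nondegenerate.eq_or_eq hw'b' hyb' (σ.mem_map hwb) (hyσ b hyb)).resolve_left hw'y))
  · exact Or.inr (Or.inr ((Nondegenerate.eq_or_eq hw'b' hyb' (σ.mem_map (σ.mem_map hwb)) (hyσ _ (hyσ b hyb))).resolve_left hw'y))

end Flag

end Collineation

end Summit.Ventures.DiscreteObjects.PP12
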